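import Mathlib

/-!
# Tier4/Line4/UnitTorsionLocal — C-L4-UNIT-TORSION, the LOCAL half: over a non-archimedean valued field, a matrix
of finite order that is `≡ 1 (mod p^{n₁})` entrywise is `1` once `p^{n₁} > 2`

Blind re-derivation cell `pub-hodge-repro`, Tier 4 «prove the step» (README §9–§10), seat t4-L2-p2 (gen 5; plan-4 g6's cut
S15670 «C-L4-UNIT-TORSION + the (S-UNIT) instance», TAKEN S15678).  Tree path
`lean/Summits/Ventures/HodgeRepro/Tier4/Line4/UnitTorsionLocal.lean`.  Mathlib-only; no literature.

THE STATEMENT.  `K` a field with a valuation `Valued.v : K → WithZero (Multiplicative ℤ)`, `p` a prime with `|p| < 1`, `n₁` with `p^{n₁} > 2`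
(i.e. `p` odd and `n₁ ≥ 1`, or `p = 2` and `n₁ ≥ 2`), `A : Matrix (Fin 4) (Fin 4) K` with every entry of `A − 1` of
valuation `≤ |p|^{n₁}`, and `A^m = 1` for some `m ≠ 0`.  Then `A = 1` (`eq_one_of_pow_eq_one_of_matV_sub_one_le`).

THE PROOF (the classical torsion-freeness of the principal congruence subgroup `1 + p^{n₁} M_4(𝓞_v)`): reduce to prime
order `ℓ` through `orderOf` (`A ↦ A^{orderOf A / ℓ}`, still `≡ 1 (mod p^{n₁})` since the congruence condition is closed
under products); write `A = 1 + X`, `t := matV X` (the sup of the entry valuations, `matV`), `t ≤ |p|^{n₁} < 1`, and expand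
`(1 + X)^ℓ − 1 = ℓ·X + Σ_{2 ≤ j ≤ ℓ} C(ℓ, j)·X^j` (`Commute.add_pow`).  The leading term has `matV = |ℓ|·t`; the middle
terms are `≤ |ℓ|·t² < |ℓ|·t` (`ℓ ∣ C(ℓ, j)`); the last term is `≤ t^ℓ < |ℓ|·t` — for `ℓ ≠ p` because `|ℓ| = 1` (Bézout), for
`ℓ = p` because `t^{p−1} ≤ |p|^{n₁(p−1)} < |p|` when `n₁(p−1) ≥ 2`.  The ultrametric inequality then gives
`matV ((1 + X)^ℓ − 1) = |ℓ|·t ≠ 0` unless `X = 0`.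

Nothing here says anything about the status of the Hodge conjecture for CM abelian varieties, which is NOT proved
(HC_CM is NOT proved by anyone in this repository).
-/

set_option autoImplicit false

noncomputable section

namespace Summit.Ventures.HodgeRepro.Tier4.Line4

open Finset

/-! ## The sup of the entry valuations of a matrix -/

section MatV

variable {K : Type} [Field K] [Valued K (WithZero (Multiplicative ℤ))] {n : ℕ}

/-- **The sup of the entry valuations** of an `n × n` matrix over a valued field. -/
def matV (X : Matrix (Fin n) (Fin n) K) : WithZero (Multiplicative ℤ) :=
  univ.sup fun ij : Fin n × Fin n => Valued.v (X ij.1 ij.2)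

/-- Every entry valuation is `≤ matV`. -/
theorem le_matV (X : Matrix (Fin n) (Fin n) K) (i j : Fin n) : Valued.v (X i j) ≤ matV X :=
  Finset.le_sup (f := fun ij : Fin n × Fin n => Valued.v (X ij.1 ij.2)) (mem_univ (i, j))

/-- `matV X ≤ c` iff every entry valuation is `≤ c`. -/
theorem matV_le_iff {X : Matrix (Fin n) (Fin n) K} {c : WithZero (Multiplicative ℤ)} : matV X ≤ c ↔ ∀ i j, Valued.v (X i j) ≤ c := by
  unfold matV
  rw [Finset.sup_le_iff]
  exact ⟨fun h i j => h (i, j) (mem_univ _), fun h ij _ => h ij.1 ij.2⟩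

/-- `matV` is attained at some entry (`n ≠ 0`). -/
theorem exists_matV_eq [NeZero n] (X : Matrix (Fin n) (Fin n) K) : ∃ i j, matV X = Valued.v (X i j) := by
  obtain ⟨ij, -, hij⟩ := Finset.exists_mem_eq_sup (univ : Finset (Fin n × Fin n)) univ_nonempty
    (fun ij : Fin n × Fin n => Valued.v (X ij.1 ij.2))
  exact ⟨ij.1, ij.2, hij⟩

/-- `matV X = 0` iff `X = 0`. -/
theorem matV_eq_zero_iff (X : Matrix (Fin n) (Fin n) K) : matV X = 0 ↔ X = 0 := by
  constructor
  · intro h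
    ext i j
    have := le_matV X i j
    rw [h] at this
    exact (Valuation.zero_iff _).1 (le_antisymm this zero_le)
  · rintro rfl
    exact le_antisymm (matV_le_iff.2 fun i j => by simp) bot_le

/-- `matV` of a sum is at most the max. -/
theorem matV_add_le (X Y : Matrix (Fin n) (Fin n) K) : matV (X + Y) ≤ max (matV X) (matV Y) :=
  matV_le_iff.2 fun i j => by
    rw [Matrix.add_apply]
    exact (Valuation.map_add _ _ _).trans (max_le_max (le_matV X i j) (le_matV Y i j))

/-- `matV` of a finite sum is at most any common bound of the terms. -/
theorem matV_sum_le {ι : Type} (s : Finset ι) (f : ι → Matrix (Fin n) (Fin n) K) {c : WithZero (Multiplicative ℤ)}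
    (hf : ∀ i ∈ s, matV (f i) ≤ c) : matV (∑ i ∈ s, f i) ≤ c :=
  matV_le_iff.2 fun a b => by
    rw [Matrix.sum_apply]
    exact Valuation.map_sum_le _ fun i hi => (le_matV (f i) a b).trans (hf i hi)

/-- `matV` is submultiplicative (ultrametric sum of the products). -/
theorem matV_mul_le (X Y : Matrix (Fin n) (Fin n) K) : matV (X * Y) ≤ matV X * matV Y :=
  matV_le_iff.2 fun i j => by
    rw [Matrix.mul_apply]
    exact Valuation.map_sum_le _ fun l _ => by
      rw [Valuation.map_mul]
      exact mul_le_mul' (le_matV X i l) (le_matV Y l j)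

/-- `matV 1 ≤ 1`. -/
theorem matV_one_le : matV (1 : Matrix (Fin n) (Fin n) K) ≤ 1 :=
  matV_le_iff.2 fun i j => by
    rw [Matrix.one_apply]
    split_ifs <;> simp

/-- `matV (X ^ m) ≤ matV X ^ m`. -/
theorem matV_pow_le (X : Matrix (Fin n) (Fin n) K) (m : ℕ) : matV (X ^ m) ≤ matV X ^ m := by
  induction m with
  | zero => simpa using matV_one_le
  | succ m ih =>
    rw [pow_succ, pow_succ]
    exact (matV_mul_le _ _).trans (mul_le_mul_left ih _)

/-- `matV (c • X) ≤ |c| · matV X` for a natural number `c`. -/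
theorem matV_nsmul_le (c : ℕ) (X : Matrix (Fin n) (Fin n) K) : matV (c • X) ≤ Valued.v (c : K) * matV X :=
  matV_le_iff.2 fun i j => by
    rw [Matrix.smul_apply, nsmul_eq_mul, Valuation.map_mul]
    exact mul_le_mul_right (le_matV X i j) _

/-- `matV (c • X) = |c| · matV X` for a natural number `c` (`n ≠ 0`). -/
theorem matV_nsmul [NeZero n] (c : ℕ) (X : Matrix (Fin n) (Fin n) K) :
    matV (c • X) = Valued.v (c : K) * matV X := by
  refine le_antisymm (matV_nsmul_le c X) ?_
  obtain ⟨i, j, hij⟩ := exists_matV_eq X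
  rw [hij]
  have := le_matV (c • X) i j
  rwa [Matrix.smul_apply, nsmul_eq_mul, Valuation.map_mul] at this

/-- **The ultrametric dominance**: if `matV Y < matV X` then `matV (X + Y) = matV X`. -/
theorem matV_add_eq_of_lt [NeZero n] {X Y : Matrix (Fin n) (Fin n) K} (h : matV Y < matV X) :
    matV (X + Y) = matV X := by
  refine le_antisymm ((matV_add_le X Y).trans (max_le le_rfl h.le)) ?_
  obtain ⟨i, j, hij⟩ := exists_matV_eq X
  have hlt : Valued.v (Y i j) < Valued.v (X i j) := (le_matV Y i j).trans_lt (hij ▸ h)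
  calc matV X = Valued.v (X i j) := hij
    _ = Valued.v ((X + Y) i j) := by rw [Matrix.add_apply, Valuation.map_add_eq_of_lt_left _ hlt]
    _ ≤ matV (X + Y) := le_matV _ i j

end MatV

/-! ## Valuations of integers -/

section Arith

variable {K : Type} [Field K] [Valued K (WithZero (Multiplicative ℤ))]

/-- `|m| ≤ 1` for every natural number `m` (ultrametric). -/
theorem valued_natCast_le_one (m : ℕ) : Valued.v (m : K) ≤ 1 := by
  induction m with
  | zero => simp
  | succ m ih =>
    rw [Nat.cast_succ]
    exact (Valuation.map_add _ _ _).trans (max_le ih (by simp))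

/-- `|m| ≤ 1` for every integer `m`. -/
theorem valued_intCast_le_one (m : ℤ) : Valued.v (m : K) ≤ 1 := by
  rcases Int.eq_nat_or_neg m with ⟨a, rfl | rfl⟩
  · simpa using valued_natCast_le_one (K := K) a
  · rw [Int.cast_neg, Int.cast_natCast, Valuation.map_neg]
    exact valued_natCast_le_one a

/-- **Bézout**: if `|p| < 1` and `q` is coprime to `p`, then `|q| = 1`. -/
theorem valued_natCast_eq_one_of_coprime {p q : ℕ} (hp : Valued.v (p : K) < 1) (hcop : Nat.Coprime p q) :
    Valued.v (q : K) = 1 := by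
  have hbez := Nat.gcd_eq_gcd_ab p q
  rw [hcop.gcd_eq_one] at hbez
  have h1 : (1 : K) = (p : K) * (Nat.gcdA p q : K) + (q : K) * (Nat.gcdB p q : K) := by
    have := congrArg (fun z : ℤ => (z : K)) hbez
    simpa using this
  refine le_antisymm (valued_natCast_le_one q) ?_
  by_contra hlt
  rw [not_le] at hlt
  have h2 : Valued.v ((p : K) * (Nat.gcdA p q : K) + (q : K) * (Nat.gcdB p q : K)) < 1 := by
    refine lt_of_le_of_lt (Valuation.map_add _ _ _) (max_lt ?_ ?_)
    · rw [Valuation.map_mul]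
      calc Valued.v (p : K) * Valued.v (Nat.gcdA p q : K) ≤ Valued.v (p : K) * 1 :=
            mul_le_mul_right (valued_intCast_le_one _) _
        _ = Valued.v (p : K) := mul_one _
        _ < 1 := hp
    · rw [Valuation.map_mul]
      calc Valued.v (q : K) * Valued.v (Nat.gcdB p q : K) ≤ Valued.v (q : K) * 1 :=
            mul_le_mul_right (valued_intCast_le_one _) _
        _ = Valued.v (q : K) := mul_one _
        _ < 1 := hlt
  rw [← h1, Valuation.map_one] at h2
  exact lt_irrefl _ h2

/-- A prime `ℓ ≠ p` is a unit at a place with `|p| < 1`. -/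
theorem valued_prime_eq_one_of_ne {p ℓ : ℕ} (hp : p.Prime) (hℓ : ℓ.Prime) (hne : ℓ ≠ p)
    (hpv : Valued.v (p : K) < 1) : Valued.v (ℓ : K) = 1 :=
  valued_natCast_eq_one_of_coprime hpv ((Nat.coprime_primes hp hℓ).2 (Ne.symm hne))

/-- `|ℓ| ≤ |c|` whenever `ℓ ∣ c`. -/
theorem valued_natCast_le_of_dvd {ℓ c : ℕ} (h : ℓ ∣ c) : Valued.v (c : K) ≤ Valued.v (ℓ : K) := by
  obtain ⟨d, rfl⟩ := h
  rw [Nat.cast_mul, Valuation.map_mul]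
  calc Valued.v (ℓ : K) * Valued.v (d : K) ≤ Valued.v (ℓ : K) * 1 := mul_le_mul_right (valued_natCast_le_one d) _
    _ = Valued.v (ℓ : K) := mul_one _

end Arith

/-! ## The congruence condition is closed under products and powers -/

section Congruence

variable {K : Type} [Field K] [Valued K (WithZero (Multiplicative ℤ))] {n : ℕ}

/-- If `A − 1` and `B − 1` have `matV ≤ t ≤ 1`, so does `A B − 1` (`AB − 1 = (A − 1)(B − 1) + (A − 1) + (B − 1)`). -/
theorem matV_mul_sub_one_le {A B : Matrix (Fin n) (Fin n) K} {t : WithZero (Multiplicative ℤ)} (ht : t ≤ 1)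
    (hA : matV (A - 1) ≤ t) (hB : matV (B - 1) ≤ t) : matV (A * B - 1) ≤ t := by
  have hid : A * B - 1 = (A - 1) * (B - 1) + (A - 1) + (B - 1) := by noncomm_ring
  rw [hid]
  refine (matV_add_le _ _).trans (max_le ((matV_add_le _ _).trans (max_le ?_ hA)) hB)
  calc matV ((A - 1) * (B - 1)) ≤ matV (A - 1) * matV (B - 1) := matV_mul_le _ _
    _ ≤ t * t := mul_le_mul' hA hB
    _ ≤ t * 1 := mul_le_mul_right ht _
    _ = t := mul_one t

/-- If `A − 1` has `matV ≤ t ≤ 1`, so does `A ^ m − 1` for every `m`. -/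
theorem matV_pow_sub_one_le {A : Matrix (Fin n) (Fin n) K} {t : WithZero (Multiplicative ℤ)} (ht : t ≤ 1)
    (hA : matV (A - 1) ≤ t) (m : ℕ) : matV (A ^ m - 1) ≤ t := by
  induction m with
  | zero =>
    rw [pow_zero, sub_self, (matV_eq_zero_iff _).2 rfl]
    exact zero_le
  | succ m ih =>
    rw [pow_succ]
    exact matV_mul_sub_one_le ht ih hA

end Congruence

/-! ## The torsion-freeness of `1 + p^{n₁} M_4(𝓞_v)` for `p^{n₁} > 2` -/

section Torsion

variable {K : Type} [Field K] [Valued K (WithZero (Multiplicative ℤ))]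

/-- `2 < p ^ n₁` for a prime `p` gives `2 ≤ n₁ (p − 1)` (and `n₁ ≠ 0`). -/
theorem two_le_mul_pred_of_two_lt_pow {p n₁ : ℕ} (hp : p.Prime) (h : 2 < p ^ n₁) : 2 ≤ n₁ * (p - 1) := by
  have h2 := hp.two_le
  rcases Nat.lt_or_ge n₁ 2 with hn | hn
  · interval_cases n₁
    · simp at h
    · rw [pow_one] at h
      omega
  · have : 1 ≤ p - 1 := by omega
    calc 2 ≤ n₁ * 1 := by omega
      _ ≤ n₁ * (p - 1) := Nat.mul_le_mul_left _ this

/-- **The prime-order case**: `A ≡ 1 (mod p^{n₁})` entrywise, `A ^ ℓ = 1` with `ℓ` prime, `p^{n₁} > 2` ⇒ `A = 1`. -/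
theorem eq_one_of_pow_prime_eq_one {p n₁ ℓ : ℕ} (hp : p.Prime) (hpv : Valued.v (p : K) < 1) (hpn : 2 < p ^ n₁)
    (hℓ : ℓ.Prime) {A : Matrix (Fin 4) (Fin 4) K} (hA : matV (A - 1) ≤ Valued.v (p : K) ^ n₁) (hAℓ : A ^ ℓ = 1) :
    A = 1 := by
  set X := A - 1 with hX
  have hAX : A = X + 1 := by rw [hX]; abel
  by_contra hne
  have hX0 : X ≠ 0 := fun h => hne (by rw [hAX, h, zero_add])
  set t := matV X with ht
  have ht0 : t ≠ 0 := fun h => hX0 ((matV_eq_zero_iff X).1 h)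
  have htpos : 0 < t := zero_lt_iff.2 ht0
  have hn₁ : n₁ ≠ 0 := by rintro rfl; simp at hpn
  have hpv0 : Valued.v (p : K) ≠ 0 := by
    intro h0
    rw [h0, zero_pow hn₁] at hA
    exact ht0 (le_antisymm hA bot_le)
  have ht1 : t < 1 := lt_of_le_of_lt hA (pow_lt_one₀ zero_le hpv hn₁)
  have hℓ2 := hℓ.two_le
  obtain ⟨r, rfl⟩ : ∃ r, ℓ = r + 2 := ⟨ℓ - 2, by omega⟩
  -- the binomial expansion of `(X + 1)^ℓ`
  have hexp : (X + 1) ^ (r + 2) = ∑ m ∈ range (r + 2 + 1), (r + 2).choose m • X ^ m := by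
    rw [(Commute.one_right X).add_pow]
    refine Finset.sum_congr rfl fun m _ => ?_
    rw [one_pow, mul_one, ← Nat.cast_comm, ← nsmul_eq_mul]
  rw [Finset.sum_range_succ', Finset.sum_range_succ'] at hexp
  simp only [zero_add, Nat.choose_zero_right, pow_zero, one_smul, Nat.choose_one_right, pow_one] at hexp
  -- `A^ℓ − 1 = ℓ • X + R`
  set R : Matrix (Fin 4) (Fin 4) K := ∑ m ∈ range (r + 1), (r + 2).choose (m + 1 + 1) • X ^ (m + 1 + 1) with hR
  have hsum : (r + 2) • X + R = 0 := by
    have h := hAℓ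
    rw [hAX, hexp] at h
    have : (r + 2) • X + R = ∑ m ∈ range (r + 1), (r + 2).choose (m + 1 + 1) • X ^ (m + 1 + 1) + (r + 2) • X + 1 - 1 := by
      rw [hR]; abel
    rw [this, h, sub_self]
  -- the valuation of `ℓ`
  have hℓv : Valued.v ((r + 2 : ℕ) : K) ≠ 0 := by
    by_cases hℓp : r + 2 = p
    · rw [hℓp]; exact hpv0
    · rw [valued_prime_eq_one_of_ne hp hℓ hℓp hpv]; exact one_ne_zero
  have hlead : matV ((r + 2) • X) = Valued.v ((r + 2 : ℕ) : K) * t := matV_nsmul (r + 2) X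
  have hleadpos : 0 < Valued.v ((r + 2 : ℕ) : K) * t := by
    rw [zero_lt_iff]; exact mul_ne_zero hℓv ht0
  -- the middle terms: `≤ |ℓ| t² < |ℓ| t`
  have hmid : Valued.v ((r + 2 : ℕ) : K) * t ^ 2 < Valued.v ((r + 2 : ℕ) : K) * t := by
    rw [pow_two]
    refine mul_lt_mul_of_pos_left ?_ (zero_lt_iff.2 hℓv)
    calc t * t < 1 * t := mul_lt_mul_of_pos_right ht1 htpos
      _ = t := one_mul t
  -- the last term: `t^ℓ < |ℓ| t`
  have hlast : t ^ (r + 2) < Valued.v ((r + 2 : ℕ) : K) * t := by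
    by_cases hℓp : r + 2 = p
    · -- `ℓ = p`: `t^{p-1} ≤ |p|^{n₁(p-1)} < |p|`
      have h2 : 2 ≤ n₁ * (p - 1) := two_le_mul_pred_of_two_lt_pow hp hpn
      have hpow : t ^ (r + 1) < Valued.v (p : K) := by
        calc t ^ (r + 1) ≤ (Valued.v (p : K) ^ n₁) ^ (r + 1) := pow_le_pow_left₀ zero_le hA _
          _ = Valued.v (p : K) ^ (n₁ * (r + 1)) := by rw [← pow_mul]
          _ < Valued.v (p : K) ^ 1 := by
            refine pow_lt_pow_right_of_lt_one₀ (zero_lt_iff.2 hpv0) hpv ?_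
            have : p - 1 = r + 1 := by omega
            rw [this] at h2
            omega
          _ = Valued.v (p : K) := pow_one _
      have hcast : ((r + 2 : ℕ) : K) = (p : K) := by rw [hℓp]
      rw [pow_succ, hcast]
      exact mul_lt_mul_of_pos_right hpow htpos
    · rw [valued_prime_eq_one_of_ne hp hℓ hℓp hpv, one_mul]
      exact pow_lt_pow_right_of_lt_one₀ htpos ht1 (by omega) |>.trans_eq (pow_one t)
  -- the remainder is strictly smaller than the leading term
  have hRlt : matV R < matV ((r + 2) • X) := by
    rw [hlead]
    refine lt_of_le_of_lt (matV_sum_le _ _ (c := max (Valued.v ((r + 2 : ℕ) : K) * t ^ 2) (t ^ (r + 2)))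
      fun m hm => ?_) (max_lt hmid hlast)
    rw [Finset.mem_range] at hm
    refine (matV_nsmul_le _ _).trans ?_
    by_cases hmr : m + 1 + 1 = r + 2
    · rw [hmr, Nat.choose_self, Nat.cast_one, Valuation.map_one, one_mul]
      exact (matV_pow_le X _).trans (le_max_right _ _)
    · refine le_trans ?_ (le_max_left _ _)
      have hdvd : r + 2 ∣ (r + 2).choose (m + 1 + 1) :=
        hℓ.dvd_choose_self (by omega) (by omega)
      calc Valued.v (((r + 2).choose (m + 1 + 1) : ℕ) : K) * matV (X ^ (m + 1 + 1))
          ≤ Valued.v ((r + 2 : ℕ) : K) * t ^ (m + 1 + 1) :=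
            mul_le_mul' (valued_natCast_le_of_dvd hdvd) (matV_pow_le X _)
        _ ≤ Valued.v ((r + 2 : ℕ) : K) * t ^ 2 :=
            mul_le_mul_right (pow_le_pow_of_le_one zero_le ht1.le (by omega)) _
  have h0 : matV ((r + 2) • X + R) = 0 := by rw [hsum]; exact (matV_eq_zero_iff _).2 rfl
  rw [matV_add_eq_of_lt hRlt, hlead] at h0
  exact hleadpos.ne' h0

/-- **C-L4-UNIT-TORSION, local form**: a matrix `A ≡ 1 (mod p^{n₁})` entrywise (`|A_ij − δ_ij| ≤ |p|^{n₁}`) of finite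
order is `1`, once `p^{n₁} > 2` (the principal congruence subgroup of level `p^{n₁}` is torsion-free). -/
theorem eq_one_of_pow_eq_one_of_matV_sub_one_le {p n₁ : ℕ} (hp : p.Prime) (hpv : Valued.v (p : K) < 1)
    (hpn : 2 < p ^ n₁) {A : Matrix (Fin 4) (Fin 4) K} (hA : matV (A - 1) ≤ Valued.v (p : K) ^ n₁) {m : ℕ}
    (hm : m ≠ 0) (hAm : A ^ m = 1) : A = 1 := by
  have hfin : IsOfFinOrder A := isOfFinOrder_iff_pow_eq_one.2 ⟨m, Nat.pos_of_ne_zero hm, hAm⟩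
  have hord : 0 < orderOf A := hfin.orderOf_pos
  by_contra hne
  have hord1 : orderOf A ≠ 1 := fun h => hne (orderOf_eq_one_iff.1 h)
  obtain ⟨ℓ, hℓ, hdvd⟩ := Nat.exists_prime_and_dvd hord1
  have hℓle : ℓ ≤ orderOf A := Nat.le_of_dvd hord hdvd
  have hB : (A ^ (orderOf A / ℓ)) ^ ℓ = 1 := by
    rw [← pow_mul, Nat.div_mul_cancel hdvd, pow_orderOf_eq_one]
  have ht1 : Valued.v (p : K) ^ n₁ ≤ 1 := pow_le_one₀ zero_le hpv.le
  have hB1 : A ^ (orderOf A / ℓ) = 1 :=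
    eq_one_of_pow_prime_eq_one hp hpv hpn hℓ (matV_pow_sub_one_le ht1 hA _) hB
  have hdvd' : orderOf A ∣ orderOf A / ℓ := orderOf_dvd_iff_pow_eq_one.2 hB1
  have hpos : 0 < orderOf A / ℓ := Nat.div_pos hℓle hℓ.pos
  have hlt : orderOf A / ℓ < orderOf A := Nat.div_lt_self hord hℓ.one_lt
  exact absurd (Nat.le_of_dvd hpos hdvd') (not_le.2 hlt)

end Torsion

end Summit.Ventures.HodgeRepro.Tier4.Line4

end
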